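/-
Origin: expansion seat `planner-pub-hodgecm-pv07-g2-0`, handover #6 2026-08-18T06:27:37Z (`HOME/pub-hodgecm-pv07-g2/lean/Pv07g2/PadicResIndex.lean`, md5 7ff4c02b, 107 lines);
landed by the gen-7 packager in gate run 25 as `HodgeCM/PerL34/LocalFactors/PadicResIndex.lean` (import ^import Pv07g2\.→import HodgeCM.PerL34.LocalFactors. ×1).
-/
/-
Copyright: HodgeCM publication cell (pub-hodgecm), DAG node N31f/N31g — split places in the D4 dilation model
(prover lineage pv07, gen 2).  Released under the package licence.

# `[ℤ_p : pℤ_p] = p`: the residue index of pv13-g3's `LocalModulus.resIndex` at `F = ℚ_p`, and the smoke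
# value `p^{-3|k|/2}` of the unramified split integrand

pv13-g3's `LocalModulus.resIndex ϖ := [𝒪 : ϖ𝒪 ∩ 𝒪]` (an index of open additive subgroups of a local field `K`,
`𝒪 = closedBall 0 1`) is the `q` of the unramified split computation (`distribHaarChar_uniformizer :
|ϖ|_K = (resIndex ϖ)⁻¹`); its identification with the residue cardinality `N(v)` of a number-field place is
the one piece of arithmetic bookkeeping left there.  This file does that bookkeeping at the prime example,
in the kernel: for `K = ℚ_[p]` (Mathlib's `Padic`) and `ϖ = p`,
* `unitBallEquiv : 𝒪 ≃+ ℤ_[p]` (Mathlib's `PadicInt` IS the subtype `‖x‖ ≤ 1`),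
* `addSubgroupOf_piBall_eq_comap` — under it, `pℤ_p ∩ ℤ_p ↦ maximalIdeal ℤ_[p] = (p)`
  (`PadicInt.norm_le_pow_iff_mem_span_pow`, `maximalIdeal_eq_span_p`),
* **`resIndex_padic : LocalModulus.resIndex (varpi p) = p`** (`PadicInt.residueField : ℤ_[p]/(p) ≃+* ZMod p`,
  `Nat.card_zmod`), hence **`distribHaarChar_padic : distribHaarChar ℚ_[p] (varpi p) = (p : ℝ≥0)⁻¹`**
  — Weil's `mod_{ℚ_p}(p) = p⁻¹` [BNT I §4 Thm 6] as a THEOREM — and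
* **`padic_smoke_unram_explicit`**: on the shell `‖y‖_p = p^{-k}` the unramified split integrand of the
  dilation-model datum (`φ⁰ = 1_{ℤ_p³}`, `ν = χ' = 1`) is LITERALLY `(EulerProduct.tOf p)^{|k|} = p^{-3|k|/2}`.
Nothing here is an input of the package.  Unit `pub-hodgecm-pv07-g2`, 2026-08-18.
-/
import Summits.HodgeConjecture.HodgeCM.PerL34.LocalFactors.SmokeDilation
import Mathlib.NumberTheory.Padics.RingHoms

/-! PORT of `HodgeCM/PerL34/LocalFactors/PadicResIndex.lean` (HodgeCMPerL run 82) — verbatim mechanical port; provenance in the PORT header line. -/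

set_option autoImplicit false

noncomputable section

open MeasureTheory Set Metric IsLocalRing
open scoped NNReal

namespace HodgeCM
namespace PerL34
namespace LocalFactors
namespace DilationModel
namespace Smoke

variable (p : ℕ) [hp : Fact p.Prime]

/-- `𝒪 = {‖x‖ ≤ 1} ⊂ ℚ_p` as an additive group IS `ℤ_p`. -/
def unitBallEquiv : (LocalModulus.unitBall ℚ_[p]).toAddSubgroup ≃+ ℤ_[p] where
  toFun x := ⟨x.1, (LocalModulus.mem_unitBall (K := ℚ_[p])).mp x.2⟩
  invFun z := ⟨z.1, (LocalModulus.mem_unitBall (K := ℚ_[p])).mpr z.2⟩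
  left_inv _ := rfl
  right_inv _ := rfl
  map_add' _ _ := rfl

/-- (Ported verbatim from the HodgeCMPerL package; no docstring in the source.) -/
@[simp] theorem coe_unitBallEquiv (x : (LocalModulus.unitBall ℚ_[p]).toAddSubgroup) :
    ((unitBallEquiv p x : ℤ_[p]) : ℚ_[p]) = (x : ℚ_[p]) := rfl

/-- under `𝒪 ≃+ ℤ_p`, the subgroup `pℤ_p ∩ ℤ_p = {‖x‖ ≤ ‖p‖}` of `𝒪` is the maximal ideal `(p)`. -/
theorem addSubgroupOf_piBall_eq_comap :
    ((LocalModulus.piBall (varpi p) : OpenAddSubgroup ℚ_[p]).toAddSubgroup).addSubgroupOf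
        (LocalModulus.unitBall ℚ_[p]).toAddSubgroup
      = ((maximalIdeal ℤ_[p]).toAddSubgroup).comap (unitBallEquiv p).toAddMonoidHom := by
  ext x
  rw [AddSubgroup.mem_addSubgroupOf, AddSubgroup.mem_comap]
  change (x : ℚ_[p]) ∈ LocalModulus.piBall (varpi p) ↔ unitBallEquiv p x ∈ maximalIdeal ℤ_[p]
  rw [LocalModulus.mem_piBall, PadicInt.maximalIdeal_eq_span_p, ← pow_one (p : ℤ_[p]),
    ← PadicInt.norm_le_pow_iff_mem_span_pow, varpi_val, Padic.norm_p]
  simp only [Nat.cast_one, zpow_neg, zpow_one]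
  rfl

/-- **`[ℤ_p : pℤ_p] = p`.** -/
theorem resIndex_padic : LocalModulus.resIndex (varpi p) = p := by
  change (((LocalModulus.piBall (varpi p) : OpenAddSubgroup ℚ_[p]).toAddSubgroup).addSubgroupOf
    (LocalModulus.unitBall ℚ_[p]).toAddSubgroup).index = p
  rw [addSubgroupOf_piBall_eq_comap,
    AddSubgroup.index_comap_of_surjective (f := (unitBallEquiv p).toAddMonoidHom) _ (unitBallEquiv p).surjective,
    AddSubgroup.index_eq_card]
  change Nat.card (ResidueField ℤ_[p]) = p
  rw [Nat.card_congr (PadicInt.residueField (p := p)).toEquiv, Nat.card_zmod]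

/-- **Weil's `mod_{ℚ_p}(p) = p⁻¹` as a theorem**: the Haar modulus of `p` acting on `ℚ_p`. -/
theorem distribHaarChar_padic : distribHaarChar ℚ_[p] (varpi p) = ((p : ℝ≥0))⁻¹ := by
  rw [LocalModulus.distribHaarChar_uniformizer (norm_varpi_lt_one p).le, resIndex_padic]

attribute [local instance] unitsBorel borelSpace_units

variable [MeasurableSpace ℚ_[p]] [BorelSpace ℚ_[p]]

/-- **Smoke, `v ∉ S` split, fully explicit (tex l. 629–630 at `F_v = ℚ_p`).**  With `φ⁰ = 1_{ℤ_p³}`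
(`vol ℤ_p³ = 1`), `ν = χ' = 1`: on the shell `‖y‖_p = p^{-k}` the integrand of the dilation-model datum is
`(tOf p)^{|k|} = p^{-3|k|/2}` — the tex's `q_v^{-3|ord y|/2}` with `q_v = p`. -/
theorem padic_smoke_unram_explicit (k : ℤ) :
    EqOn (splitIntegrand (muV p) 0 1 (muG p) 1 1).f
      (fun _ => ((EulerProduct.tOf p : ℝ) : ℂ) ^ k.natAbs) (shell (varpi p) k) := by
  intro y hy
  rw [(padic_smoke_unram p k).1 hy]
  simp only [resIndex_padic]

/-- … numerically: `tOf p = p^{-3/2}`, so the value is `p^{-3|k|/2}`. -/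
theorem padic_smoke_unram_rpow (k : ℤ) :
    EqOn (splitIntegrand (muV p) 0 1 (muG p) 1 1).f
      (fun _ => (((p : ℝ) ^ (-(3 / 2 : ℝ) * (k.natAbs : ℝ)) : ℝ) : ℂ)) (shell (varpi p) k) := by
  intro y hy
  rw [padic_smoke_unram_explicit p k hy, EulerProduct.tOf, ← Complex.ofReal_pow,
    ← Real.rpow_mul_natCast (Nat.cast_nonneg p)]

end Smoke
end DilationModel
end LocalFactors
end PerL34
end HodgeCM

end
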